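import Literature.IUT.LogVolume.Corollary22ThetaClosureOrbit
import Literature.IUT.LogVolume.Corollary22QParamBaseChange
import Literature.IUT.HodgeTheaters.InitialThetaDataTripod
import Literature.NumberTheory.EllipticCurves.FrobeniusTwist
import Literature.AlgebraicGeometry.PlaneCurves.LegendreFormClassification
import HarnessLib

/-!
# The theta closure field `F‡ = F_tpd(√−1, √λ, √(λ−1), E_λ[3·5])` is GALOIS OVER `F_mod`

Mochizuki, *Inter-universal Teichmüller theory I*, Def. 3.1 (b) (kurims May-2020 p. 61): "`F` is Galois over
`F_mod`"; *IV*, Thm. 1.10, p. 22: "`F = F_mod(√−1, E_{F_mod}[2·3·5]) := F_tpd(√−1, E_{F_tpd}[3·5])`". By the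
cell's findings F-L5t7-1 / F-L5t7-2 (= F-c312-8-g3-1) the printed field need not be Galois over `F_mod` and no
`F_mod`-model repairs it without breaking Step (iii) (D0); the field of record (abc-iut-plan 2026-08-26T02:59:03Z)
is the Galois closure `F‡` of `Corollary22ThetaClosureField.lean`. THIS FILE proves the closure property
(proof-only; the orbit half is `Corollary22ThetaClosureOrbit.lean`):

* `map_lambda_mem_anharmonicSet` — an `F_mod`-automorphism `σ` of `F̄_tpd` moves `λ` within its anharmonic
  orbit (`σ` fixes `j(λ) ∈ F_mod`; Kunz 10.12 = the tree's `legendre_j_eq_iff`);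
* `map_mem_thetaClosureField` — `σ(F‡) ⊆ F‡` for every `σ ∈ Aut(F̄_tpd / F_mod)` (`F_tpd = F_mod(λ)` for a
  minimally presented point; torsion points of `E_λ` go to torsion points of `E_{σλ}` by the tree's
  `WeierstrassCurve.mapPoint`; the orbit is good);
* **`isGalois_fMod_thetaClosureField : IsGalois (FMod P) (thetaClosureField P)`** — [IUTchI] Def. 3.1 (b) for
  `F‡` — and `finrank_fMod_thetaClosureField_coprime` (`[F‡ : F_mod] = [F‡ : F_tpd]·[F_tpd : F_mod]`,
  `[F_tpd : F_mod] ≤ 6`: prime to every prime `l ≥ 7`).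

Classical Galois theory of the Legendre family, kernel-checked; TAKES NO SIDE on [IUTchIII] Cor. 3.12. IUT
quotations carry [claim: Mochizuki2012, status: disputed]; every declaration here is a proved theorem.
-/

noncomputable section

open scoped Classical

namespace Literature.IUT.LogVolume

namespace Cor22

open NumberField IsDedekindDomain Literature.NumberTheory.DiophantineGeometry.GenEll
open Literature.NumberTheory.EllipticCurves WeierstrassCurve IntermediateField Field
open Literature.IUT.HodgeTheaters Literature.AlgebraicGeometry.PlaneCurves

variable (P : NFPoint)

/-! ## `F_mod`-automorphisms of `F̄_tpd` -/

section Automorphisms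

/-- `j(λ) ∈ F̄_tpd` comes from `F_mod`. [cite: Mochizuki2012, IUTchIV Cor. 2.2 (ii) p.42] -/
theorem algebraMap_jInv_eq :
    algebraMap P.F (AlgebraicClosure P.F) (jInv P.x) = algebraMap (FMod P) (AlgebraicClosure P.F) (jMod P) := by
  rw [IsScalarTower.algebraMap_apply (FMod P) P.F (AlgebraicClosure P.F)]
  rfl

/-- **An `F_mod`-automorphism of `F̄_tpd` moves `λ` within its anharmonic orbit** (it fixes `j(λ) ∈ F_mod`, and the
`λ`'s with a given `j` are the six cross-ratio transforms — Kunz 10.12, the tree's `legendre_j_eq_iff`).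
[cite: MochizukiGenEll2010, Rmk 4.4.2 p.24] -/
theorem map_lambda_mem_anharmonicSet (hU : P.InU)
    (σ : AlgebraicClosure P.F ≃ₐ[FMod P] AlgebraicClosure P.F) :
    σ (algebraMap P.F (AlgebraicClosure P.F) P.x) ∈ NFPoint.anharmonicSet (algebraMap P.F (AlgebraicClosure P.F) P.x) := by
  set la := algebraMap P.F (AlgebraicClosure P.F) P.x with hla
  have h2 : (2 : AlgebraicClosure P.F) ≠ 0 := two_ne_zero
  have h0 : la ≠ 0 := by rw [hla]; exact (map_ne_zero _).2 hU.1
  have h1 : la ≠ 1 := by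
    rw [hla]; intro h; exact hU.2 ((map_eq_one_iff _ (algebraMap P.F _).injective).1 h)
  have hs0 : σ la ≠ 0 := by rwa [ne_eq, map_eq_zero_iff σ σ.injective]
  have hs1 : σ la ≠ 1 := by
    intro h; apply h1; apply σ.injective; rw [h, map_one]
  haveI hEl : (⟨0, -(1 + la), 0, la, 0⟩ : WeierstrassCurve (AlgebraicClosure P.F)).IsElliptic :=
    (legendre_isElliptic_iff h2 la).2 ⟨h0, h1⟩
  haveI hEs : (⟨0, -(1 + σ la), 0, σ la, 0⟩ : WeierstrassCurve (AlgebraicClosure P.F)).IsElliptic :=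
    (legendre_isElliptic_iff h2 (σ la)).2 ⟨hs0, hs1⟩
  have hj : (⟨0, -(1 + la), 0, la, 0⟩ : WeierstrassCurve (AlgebraicClosure P.F)).j =
      (⟨0, -(1 + σ la), 0, σ la, 0⟩ : WeierstrassCurve (AlgebraicClosure P.F)).j := by
    rw [legendre_j h2 la, legendre_j h2 (σ la)]
    change jInv la = jInv (σ la)
    have e1 : jInv (σ la) = σ (jInv la) := (jInv_map (σ : AlgebraicClosure P.F →+* AlgebraicClosure P.F) la).symm
    rw [e1, hla, ← jInv_map (algebraMap P.F (AlgebraicClosure P.F)) P.x, algebraMap_jInv_eq, AlgEquiv.commutes]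
  have h := (legendre_j_eq_iff h2 (la := la) (mu := σ la)).1 hj
  simp only [NFPoint.anharmonicSet, Set.mem_insert_iff, Set.mem_singleton_iff]
  tauto

/-- The anharmonic orbit of `λ` lies in `F‡` (indeed in `F_tpd`). [cite: MochizukiGenEll2010, Rmk 4.4.2 p.24] -/
theorem mem_thetaClosureField_of_mem_anharmonicSet {μ : AlgebraicClosure P.F}
    (hμ : μ ∈ NFPoint.anharmonicSet (algebraMap P.F (AlgebraicClosure P.F) P.x)) : μ ∈ thetaClosureField P := by
  have hla : algebraMap P.F (AlgebraicClosure P.F) P.x ∈ thetaClosureField P := IntermediateField.algebraMap_mem _ _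
  simp only [NFPoint.anharmonicSet, Set.mem_insert_iff, Set.mem_singleton_iff] at hμ
  rcases hμ with rfl | rfl | rfl | rfl | rfl | rfl
  · exact hla
  · exact inv_mem hla
  · exact sub_mem (one_mem _) hla
  · exact inv_mem (sub_mem (one_mem _) hla)
  · exact div_mem hla (sub_mem hla (one_mem _))
  · exact div_mem (sub_mem hla (one_mem _)) hla

/-- An `F_mod`-automorphism maps `F_tpd = F_mod(λ)` into `F‡` (minimally presented point).
[cite: Mochizuki2012, IUTchIV Cor. 2.2 (ii) p.42] -/
theorem map_algebraMap_mem_thetaClosureField (hP : P ∈ UP)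
    (σ : AlgebraicClosure P.F ≃ₐ[FMod P] AlgebraicClosure P.F) (k : P.F) :
    σ (algebraMap P.F (AlgebraicClosure P.F) k) ∈ thetaClosureField P := by
  have hk : k ∈ IntermediateField.adjoin (FMod P) ({P.x} : Set P.F) := by
    rw [adjoin_fMod_x_eq_top P hP.2]; exact mem_top
  induction hk using adjoin_induction with
  | mem x hx =>
    rw [Set.mem_singleton_iff] at hx
    rw [hx]
    exact mem_thetaClosureField_of_mem_anharmonicSet P (map_lambda_mem_anharmonicSet P hP.1 σ)
  | algebraMap c =>
    rw [← IsScalarTower.algebraMap_apply, AlgEquiv.commutes, IsScalarTower.algebraMap_apply (FMod P) P.F]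
    exact IntermediateField.algebraMap_mem _ _
  | add x y _ _ hx hy => rw [map_add, map_add]; exact add_mem hx hy
  | inv x _ hx => rw [map_inv₀, map_inv₀]; exact inv_mem hx
  | mul x y _ _ hx hy => rw [map_mul, map_mul]; exact mul_mem hx hy

/-- An `F_mod`-automorphism `σ` carries the Legendre curve of `λ` to that of `σλ`.
[cite: SilvermanAEC2009, VIII.§1] -/
theorem map_legendreCurve_baseChange (σ : AlgebraicClosure P.F ≃ₐ[FMod P] AlgebraicClosure P.F) :
    (P.legendreCurve.baseChange (AlgebraicClosure P.F)).map
        (σ : AlgebraicClosure P.F →+* AlgebraicClosure P.F) =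
      ⟨0, -(1 + σ (algebraMap P.F _ P.x)), 0, σ (algebraMap P.F _ P.x), 0⟩ := by
  rw [legendreCurve_baseChange_eq]
  ext <;> simp [WeierstrassCurve.map]

/-- **`σ(F‡) ⊆ F‡` for every `F_mod`-automorphism `σ` of `F̄_tpd`** (the generators go to square roots of
`−1, σλ, σλ−1` and to coordinates of `15`-torsion points of `E_{σλ}`, all in `F‡` by goodness of the orbit;
`F_tpd` goes into `F‡`). [claim: Mochizuki2012, status: disputed] -/
theorem map_mem_thetaClosureField (hP : P ∈ UP) (σ : AlgebraicClosure P.F ≃ₐ[FMod P] AlgebraicClosure P.F)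
    {x : AlgebraicClosure P.F} (hx : x ∈ thetaClosureField P) : σ x ∈ thetaClosureField P := by
  have good := good_of_mem_anharmonicSet P hP.1 (map_lambda_mem_anharmonicSet P hP.1 σ)
  obtain ⟨gsq, gsq1, gtor⟩ := good
  change x ∈ adjoin P.F (thetaClosureGens P) at hx
  induction hx using adjoin_induction with
  | mem z hz =>
    rcases hz with hz | hz
    · obtain ⟨a, ha, hza⟩ := Set.mem_iUnion₂.1 hz
      rw [Set.mem_setOf_eq] at hza
      have hσz : (σ z) ^ 2 = σ (algebraMap P.F _ a) := by rw [← map_pow, hza]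
      simp only [thetaClosureRadicands, Set.mem_insert_iff, Set.mem_singleton_iff] at ha
      rcases ha with rfl | rfl | rfl
      · refine sqrt_neg_one_mem P ?_
        rw [hσz, map_neg, map_one, map_neg, map_one]
      · exact gsq _ hσz
      · refine gsq1 _ ?_
        rw [hσz, map_sub, map_one, map_sub, map_one]
    · obtain ⟨T, hT, hzT⟩ := Set.mem_iUnion₂.1 hz
      -- carry `T` to a `15`-torsion point of `E_{σλ}` along `σ`
      set T' := WeierstrassCurve.mapPoint (σ : AlgebraicClosure P.F →+* AlgebraicClosure P.F)
        (map_legendreCurve_baseChange P σ) T with hT'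
      have hT'tor : (15 : ℤ) • T' = 0 := by
        rw [hT', ← map_zsmul]
        exact (congrArg _ hT).trans (map_zero _)
      refine gtor T' hT'tor (σ z) ?_
      -- the coordinates of `T'` are `σ` of those of `T`
      revert hzT
      rcases T with _ | ⟨a, b, hab⟩
      · intro hzT; simp [pointCoords] at hzT
      · intro hzT
        rw [hT', WeierstrassCurve.mapPoint_some]
        simp only [pointCoords, Set.mem_insert_iff, Set.mem_singleton_iff] at hzT ⊢
        rcases hzT with rfl | rfl
        · exact Or.inl rfl
        · exact Or.inr rfl
  | algebraMap k => exact map_algebraMap_mem_thetaClosureField P hP σ k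
  | add x y _ _ hx hy => rw [map_add]; exact add_mem hx hy
  | inv x _ hx => rw [map_inv₀]; exact inv_mem hx
  | mul x y _ _ hx hy => rw [map_mul]; exact mul_mem hx hy

end Automorphisms

/-! ## `F‡ / F_mod` is Galois -/

section Galois

/-- `F̄_tpd / F_mod` is normal (algebraic, and every polynomial splits in an algebraically closed field).
[cite: MilneFT2022, Ch. 7 (the algebraic closure is normal)] -/
theorem normal_fMod_algebraicClosure : Normal (FMod P) (AlgebraicClosure P.F) := by
  haveI : Module.Finite (FMod P) P.F := Module.Finite.of_restrictScalars_finite ℚ (FMod P) P.F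
  haveI : Algebra.IsAlgebraic (FMod P) P.F := Algebra.IsAlgebraic.of_finite (FMod P) P.F
  haveI : Algebra.IsAlgebraic (FMod P) (AlgebraicClosure P.F) :=
    Algebra.IsAlgebraic.trans (FMod P) P.F (AlgebraicClosure P.F)
  rw [normal_iff]
  intro x
  exact ⟨(Algebra.IsAlgebraic.isAlgebraic x).isIntegral, IsAlgClosed.splits _⟩

/-- **[IUTchI] Def. 3.1 (b) for `F‡`: `F‡` is Galois over `F_mod`** (normal: stable under `Aut(F̄_tpd/F_mod)`;
separable: characteristic `0`). [claim: Mochizuki2012, status: disputed] -/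
theorem isGalois_fMod_thetaClosureField (hP : P ∈ UP) : IsGalois (FMod P) (thetaClosureField P) := by
  haveI := normal_fMod_algebraicClosure P
  haveI hN : Normal (FMod P) ((thetaClosureField P).restrictScalars (FMod P)) := by
    rw [normal_iff_forall_map_le']
    intro σ x hx
    rw [IntermediateField.mem_map] at hx
    obtain ⟨y, hy, rfl⟩ := hx
    exact map_mem_thetaClosureField P hP σ hy
  haveI : Normal (FMod P) (thetaClosureField P) := hN
  exact ⟨⟩

/-- **`[F_tpd : F_mod] ≤ 6`** is prime to every prime `l ≥ 7`; hence **`[F‡ : F_mod]` is prime to every prime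
`l ≥ 7`** ([IUTchI] Def. 3.1 (b) "of degree prime to `l`"). [claim: Mochizuki2012, status: disputed] -/
theorem finrank_fMod_thetaClosureField_coprime (hP : P ∈ UP) {l : ℕ} (hl : l.Prime) (h7 : 7 ≤ l) :
    (Module.finrank (FMod P) (thetaClosureField P)).Coprime l := by
  haveI : Module.Finite (FMod P) P.F := Module.Finite.of_restrictScalars_finite ℚ (FMod P) P.F
  rw [← Module.finrank_mul_finrank (FMod P) P.F (thetaClosureField P)]
  refine Nat.Coprime.mul_left ?_ (finrank_thetaClosureField_coprime P hP.1 hl h7)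
  -- `[F_tpd : F_mod] ≤ 6 < l`
  have hle : Module.finrank (FMod P) P.F ≤ 6 := by
    have hmin := Literature.IUT.HodgeTheaters.minpoly_x_dvd_anharmonicPoly P hP.1
    have hint : IsIntegral (FMod P) P.x := Algebra.IsIntegral.isIntegral _
    have htop : Module.finrank (FMod P) P.F =
        Module.finrank (FMod P) (IntermediateField.adjoin (FMod P) ({P.x} : Set P.F)) := by
      rw [adjoin_fMod_x_eq_top P hP.2, IntermediateField.finrank_top']
    rw [htop, IntermediateField.adjoin.finrank hint]
    have hne : anharmonicPoly (jMod P) ≠ 0 := anharmonicPoly_ne_zero _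
    refine (Polynomial.natDegree_le_of_dvd hmin hne).trans ?_
    unfold anharmonicPoly
    compute_degree!
  have hpos : 0 < Module.finrank (FMod P) P.F := Module.finrank_pos
  rw [Nat.Coprime, Nat.gcd_comm]
  change Nat.Coprime l _
  rw [Nat.Prime.coprime_iff_not_dvd hl]
  intro hdvd
  have := Nat.le_of_dvd hpos hdvd
  omega

end Galois

end Cor22

end Literature.IUT.LogVolume

end
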